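import Summits.NavierStokesRegularity.NavierStokesRegularity.Theorems.ScenarioCensusRowF1NeedleTop
import HarnessLib

/-!
# LINE 37 «needle-top» port, part 2/3: §4 the ONE-DIMENSIONAL KILL (radial analytic continuation into the normalisation point: `needle_kill`, `needle_limit`,
# `NeedleDefectBelow`, `exists_needleLevel`); §5 the calm-needle row PROVED (`rowF1nd_holds`, `rowF1ne_holds`), the threshold `needleLevel`, the HEDGEHOG floor, residual
# `NeedleCollapse` ≡ `Row_F1`, order vs LINE 36 / «caged-top» (`rowF1cs_of_rowF1nd`, `rowF1po_of_rowF1nd`; LINE 36's block BY NAME)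

Re-homed for the scenario census (typer seat ns-census-typer-1 g10; the cells F1nd / F1ne / F1sc and the floors HF / SWF are MEMBERS OF RECORD «DECIDED IN KERNEL IN FILES» of row F1
(item 78: critic idea-crit-3 g9 PASS no price 11:16:43Z; ref PRE-CHECK ✓; lead label LBL78); this port makes them TREE-decided): VERBATIM PORT of ns-idea-3 LINE 37 «needle-top»,
`pub/ideators/ns-idea-3/lines/needle-top/line-needle-top.lean` sha16 a98a4df70fd31916 (1057 l., lean check rc 0, 0 sorry), split for the 400-line rule into
`ScenarioCensusRowF1NeedleTop` (§1–§3) → `…NeedleTopRows` (§4–§5) → `…NeedleTopSector` (§6–§7 + census KEYS).  Lean text VERBATIM in namespace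
`…Theorems.ScenarioCensus.NeedleTop` (the line's `…Cruxes.ScenarioCensusRowF1.NeedleTopLine` re-homed); port edits: the frame restated VERBATIM by the line from LINES 34/35/36
and «caged-top» (`topSet`, `HasTypeIConstant`, `snapLevel`, `exists_fast_at`, `CalmPocketsAt`, `Row_F1cs`, `HasPorousTopAt`, `IsSubcriticalLevel`, `HasPorousTop`, `Row_F1po`, order
lemmas) is taken BY NAME from the landed two-time-top / one-level-top / snapshot-top ports; the second proof terms `rowF1cs_holds` / `rowF1po_holds` are not re-declared
(routes `rowF1cs_of_rowF1nd rowF1nd_holds`, `rowF1po_of_rowF1nd rowF1nd_holds`); the line's NEW compactness / socket / zoom package WITH the locally-uniform clause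
(`limitClass_compact`, `exists_level_of_limitKill`, `exists_snapshotZoom_package`) are kept verbatim (new statements); the bookkeeping lemma `tendstoLocallyUniformly_comp_of_tendsto` (a twin of a landed lemma in a route-cone module) is not re-declared, its 3-line proof is inlined at the one use site; `@[conjecture]` on the residual `NeedleCollapse`
(≡ `ScenarioCensus.Row_F1`, OPEN); one-line docstrings added where missing (gate lint).  Statements untouched.

No census VALUE is moved here (row F1 stays OPEN-WITH-LINE; the members become TREE-decided by name); NS regularity is NOT proved; `Row_F1` is untouched (zero
movement, `needleCollapse_iff_rowF1`); no summit statement is proved by this file. Lemmas that restate already-landed tree declarations are taken BY NAME (gate lint `dedup.landed`): `topSet` = `TwoTimeTop.topSet`, `HasTypeIConstant` = `OneLevelTop.HasTypeIConstant`, `snapLevel` = `SnapshotTop.snapLevel`, `exists_fast_at` = `SnapshotTop.exists_fast_at`, `sqrt_mul_sq_mul` = `SnapshotTop.sqrt_mul_sq_mul`, `CalmPocketsAt` = `SnapshotTop.CalmPocketsAt`, `Row_F1cs` = `SnapshotTop.Row_F1cs`, `HasPorousTopAt` = `SnapshotTop.HasPorousTopAt`, `IsSubcriticalLevel` = `SnapshotTop.IsSubcriticalLevel`,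 `HasPorousTop` = `SnapshotTop.HasPorousTop`, `Row_F1po` = `SnapshotTop.Row_F1po`, `eventually_calmPocketsAt_of_porous` = `SnapshotTop.eventually_calmPocketsAt_of_porous`, `rowF1po_of_rowF1cs` = `SnapshotTop.rowF1po_of_rowF1cs`.
-/

-- the summit and its single problem share the name `NavierStokesRegularity` (D-0017 nested layout)
set_option linter.dupNamespace false

noncomputable section

open MeasureTheory Set Function Filter TopologicalSpace Metric
open scoped Topology NNReal ENNReal InnerProductSpace

namespace Summit.NavierStokesRegularity.NavierStokesRegularity.Theorems.ScenarioCensus.NeedleTop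

open Literature.Analysis Literature.Analysis.FluidPDE
open Summit.NavierStokesRegularity.NavierStokesRegularity.Theorems
open Summit.NavierStokesRegularity.NavierStokesRegularity.Theses

/-! ## §4 MECHANISM, part 2 — the ONE-DIMENSIONAL KILL: radial analytic continuation INTO the normalisation point

Every earlier kill of this seat read the limit `W ∈ 𝒦_M` on a set with INTERIOR (a space-time open set: Liouville theorems, time
windows; LINE 36: a BALL on one slice, killed by the identity theorem in `ℝ³`).  A needle is a SEGMENT on one slice: no interior,
measure zero — the identity theorem in `ℝ³` says nothing about a function vanishing on a segment (`y ↦ y₂` vanishes on the whole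
`y₁`-axis).  What kills is ONE-DIMENSIONAL and uses the one piece of structure a radial needle has: ITS CARRIER LINE PASSES THROUGH
THE NORMALISATION POINT `y = 0`.  The slice `W(−1, ·)` is real-analytic on `ℝ³` (tree `IsTypeIAncientMild.analyticOnNhd_slice_univ`),
so for every continuous linear read-out `L` and direction `e` the function `r ↦ L(W(−1, r e))` is real-analytic on the connected
line `ℝ`; if it vanishes on an open interval of radii it vanishes identically, in particular AT `r = 0`: `L(W(−1, 0)) = 0`.  With
`L = id` (calm needle) this contradicts `‖W(−1, 0)‖ ≥ c_S` outright; with `L = ⟨·, e⟩` for a cap of directions `e` (radially calm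
sector, §6) the vectors `e` span and again `W(−1, 0) = 0`.  The needle must be RADIAL: a calm segment missing the fast point gives
nothing (and should give nothing — shear layers next to fast points are not excluded by anything known). -/

/-- **(KN) THE NEEDLE KILL.**  `W ∈ 𝒦_M`, `t < 0`, `L` a continuous linear read-out, `e` any vector: if `L(W(t, r e)) = 0` for `r`
in a non-empty open interval, then `L(W(t, 0)) = 0` — analytic continuation along the ray into the centre. -/
theorem needle_kill {M : ℝ} {W : ℝ → E3 → E3} (hW : IsTypeIAncientMild M W) {t : ℝ} (ht : t < 0)
    {F : Type*} [NormedAddCommGroup F] [NormedSpace ℝ F] (L : E3 →L[ℝ] F) (e : E3) {r₁ r₂ : ℝ} (hr : r₁ < r₂)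
    (h : ∀ r ∈ Ioo r₁ r₂, L (W t (r • e)) = 0) : L (W t 0) = 0 := by
  have hray : ∀ r : ℝ, AnalyticAt ℝ (fun r : ℝ => r • e) r := fun r =>
    (ContinuousLinearMap.toSpanSingleton ℝ e).analyticAt r
  have han : AnalyticOnNhd ℝ (fun r : ℝ => L (W t (r • e))) univ := by
    intro r _
    have h2 : AnalyticAt ℝ (W t) (r • e) := hW.analyticOnNhd_slice_univ ht _ (mem_univ _)
    have h3 : AnalyticAt ℝ (W t ∘ fun r : ℝ => r • e) r :=
      AnalyticAt.comp (g := W t) (f := fun r : ℝ => r • e) (x := r) h2 (hray r)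
    exact (L.analyticAt _).comp h3
  have hmid₁ : r₁ < (r₁ + r₂) / 2 := by linarith
  have hmid₂ : (r₁ + r₂) / 2 < r₂ := by linarith
  have hz : ∀ᶠ r in 𝓝 ((r₁ + r₂) / 2), L (W t (r • e)) = 0 := by
    filter_upwards [Ioo_mem_nhds hmid₁ hmid₂] with r hr'
    exact h r hr'
  have hEq : EqOn (fun r : ℝ => L (W t (r • e))) 0 univ :=
    han.eqOn_zero_of_preconnected_of_eventuallyEq_zero isPreconnected_univ (mem_univ ((r₁ + r₂) / 2)) hz
  have h0 := hEq (mem_univ (0 : ℝ))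
  simpa using h0

/-- **(KN₀) A slice vanishing on a radial segment vanishes at the centre** (`L = id`). -/
theorem eq_zero_of_needle {M : ℝ} {W : ℝ → E3 → E3} (hW : IsTypeIAncientMild M W) {t : ℝ} (ht : t < 0) (e : E3)
    {r₁ r₂ : ℝ} (hr : r₁ < r₂) (h : ∀ r ∈ Ioo r₁ r₂, W t (r • e) = 0) : W t 0 = 0 := by
  have h1 := needle_kill hW ht (ContinuousLinearMap.id ℝ E3) e hr (fun r hr' => by simp [h r hr'])
  simpa using h1

/-- **Needles pass to locally uniform limits** (compactness of the needle parameters `(e_j, r₀_j) ∈ D × [0, A]` and evaluation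
of a locally uniformly convergent sequence along a convergent sequence of points): if `f_j → g` locally uniformly with `g`
continuous, `‖f_j((r₀_j + ρ) e_j)‖ ≤ b_j` for `ρ ∈ [0, a]`, and `b_j → b₀`, then `‖g((ρ₀ + ρ) e₀)‖ ≤ b₀` for `ρ ∈ [0, a]`, for some
`e₀ ∈ D`, `ρ₀ ∈ [0, A]`.  (Pointwise convergence would NOT suffice: the needles move.) -/
theorem needle_limit {F : Type*} [NormedAddCommGroup F] {D : Set E3} (hD : IsCompact D) {A a : ℝ}
    {f : ℕ → E3 → F} {g : E3 → F} (hfg : TendstoLocallyUniformly f g atTop) (hg : Continuous g)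
    {e : ℕ → E3} (he : ∀ j, e j ∈ D) {r₀ : ℕ → ℝ} (hr₀ : ∀ j, r₀ j ∈ Icc (0 : ℝ) A)
    {b : ℕ → ℝ} {b₀ : ℝ} (hb : Tendsto b atTop (𝓝 b₀))
    (hf : ∀ j, ∀ ρ ∈ Icc (0 : ℝ) a, ‖f j ((r₀ j + ρ) • e j)‖ ≤ b j) :
    ∃ e₀ ∈ D, ∃ ρ₀ ∈ Icc (0 : ℝ) A, ∀ ρ ∈ Icc (0 : ℝ) a, ‖g ((ρ₀ + ρ) • e₀)‖ ≤ b₀ := by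
  have hK : IsCompact (D ×ˢ Icc (0 : ℝ) A) := hD.prod isCompact_Icc
  have hmem : ∀ j, (fun j => (e j, r₀ j)) j ∈ D ×ˢ Icc (0 : ℝ) A := fun j => ⟨he j, hr₀ j⟩
  obtain ⟨q, hq, ψ, hψ, hlim⟩ := hK.tendsto_subseq hmem
  obtain ⟨he₀, hρ₀⟩ := hq
  refine ⟨q.1, he₀, q.2, hρ₀, fun ρ hρ => ?_⟩
  have hψt : Tendsto ψ atTop atTop := hψ.tendsto_atTop
  have hlim' := (Prod.tendsto_iff _ _).1 hlim
  have he_lim : Tendsto (fun j => e (ψ j)) atTop (𝓝 q.1) := hlim'.1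
  have hr_lim : Tendsto (fun j => r₀ (ψ j)) atTop (𝓝 q.2) := hlim'.2
  have hy : Tendsto (fun j => (r₀ (ψ j) + ρ) • e (ψ j)) atTop (𝓝 ((q.2 + ρ) • q.1)) :=
    (hr_lim.add tendsto_const_nhds).smul he_lim
  have hfgψ : TendstoLocallyUniformly (fun j => f (ψ j)) g atTop := fun v hv z => by
    obtain ⟨t, ht, hev⟩ := hfg v hv z
    exact ⟨t, ht, hψt.eventually hev⟩
  have h1 : Tendsto (fun j => f (ψ j) ((r₀ (ψ j) + ρ) • e (ψ j))) atTop (𝓝 (g ((q.2 + ρ) • q.1))) :=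
    hfgψ.tendsto_comp hg.continuousAt hy
  exact le_of_tendsto_of_tendsto h1.norm (hb.comp hψt) (Eventually.of_forall fun j => hf (ψ j) ρ hρ)

/-- The **needle defect below `Λ`** of `W` on the slice `s = −1` (reach `A`, length `a`): some unit direction `e` and start
`r₀ ∈ [0, A]` with `‖W(−1, (r₀ + ρ) e)‖ ≤ Λ` for `ρ ∈ [0, a]`. -/
def NeedleDefectBelow (A a Λ : ℝ) (W : ℝ → E3 → E3) : Prop :=
  ∃ e : E3, ‖e‖ = 1 ∧ ∃ r₀ ∈ Icc (0 : ℝ) A, ∀ ρ ∈ Icc (0 : ℝ) a, ‖W (-1) ((r₀ + ρ) • e)‖ ≤ Λ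

/-- **THE CALM-NEEDLE LEVEL `Λ₁(M, A, a, κ)`**: no `W ∈ 𝒦_M` with `‖W(−1, 0)‖ ≥ κ` has needle defect below `Λ₁`
(socket of §2 + needle limit + (KN₀)). -/
theorem exists_needleLevel (M A a : ℝ) (ha : 0 < a) {κ : ℝ} (hκ : 0 < κ) :
    ∃ Λ₁ : ℝ, 0 < Λ₁ ∧ ∀ W : ℝ → E3 → E3, IsTypeIAncientMild M W → κ ≤ ‖W (-1) 0‖ →
      ¬ NeedleDefectBelow A a Λ₁ W := by
  refine exists_level_of_limitKill M hκ (NeedleDefectBelow A a) ?_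
  intro Wn W ε hεpos hεlim hWn hW hP _ _ hlu
  choose e he r₀ hr₀ hcalm using hP
  have hcont : Continuous (W (-1)) := hW.continuous_slice (by norm_num)
  have hsph : ∀ j, e j ∈ sphere (0 : E3) 1 := fun j => mem_sphere_zero_iff_norm.2 (he j)
  obtain ⟨e₀, -, ρ₀, -, hlim⟩ :=
    needle_limit (isCompact_sphere (0 : E3) 1) (hlu (-1) (by norm_num)) hcont hsph hr₀ hεlim hcalm
  have hzero : ∀ r ∈ Ioo ρ₀ (ρ₀ + a), W (-1) (r • e₀) = 0 := by
    intro r hr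
    have h0 : ‖W (-1) ((ρ₀ + (r - ρ₀)) • e₀)‖ ≤ 0 := hlim (r - ρ₀) ⟨by linarith [hr.1], by linarith [hr.2]⟩
    rw [show ρ₀ + (r - ρ₀) = r by ring] at h0
    exact norm_le_zero_iff.1 h0
  exact eq_zero_of_needle hW (by norm_num) e₀ (by linarith) hzero

/-! ## §5 The CALM-NEEDLE ROW, proved; the definite threshold `needleLevel M A a`; the HEDGEHOG floor; residual ≡ row F1; order -/

/-- The parabolic units at the centre times of the package. -/
theorem zoom_units {ν T : ℝ} (hν : 0 < ν) {c : ℕ → ℝ} (hcpos : ∀ j, 0 < c j) (j : ℕ) :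
    Real.sqrt (ν * (T - (T + c j ^ 2 * ν * (-1)))) = c j * ν ∧
      Real.sqrt (T - (T + c j ^ 2 * ν * (-1))) = c j * Real.sqrt ν := by
  refine ⟨?_, ?_⟩
  · rw [show T - (T + c j ^ 2 * ν * (-1)) = c j ^ 2 * ν by ring]
    exact SnapshotTop.sqrt_mul_sq_mul hν (hcpos j)
  · rw [show T - (T + c j ^ 2 * ν * (-1)) = c j ^ 2 * ν by ring, Real.sqrt_mul (sq_nonneg _),
      Real.sqrt_sq (hcpos j).le]

/-- **ROW F1nd holds** (snapshot package of §3 + needle level of §4). -/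
theorem rowF1nd_holds : Row_F1nd := by
  intro M A a ha
  obtain ⟨Λ₁, hΛ₁, hlev⟩ := exists_needleLevel M A a ha SnapshotTop.snapLevel_pos
  refine ⟨Λ₁, hΛ₁, ?_⟩
  intro ν T hν hT u p hsol hLH hdec hM hfreq
  by_contra hmax
  obtain ⟨c, x, W, hcpos, -, hW, hQ, hxfast, -, -, hlu, hnorm⟩ :=
    exists_snapshotZoom_package hν hT hsol hLH hdec hM hmax hfreq
  apply hlev W hW hnorm
  -- the snapshot hypothesis at the centre times, read in the zoom: calm needles `(e_j, r₀_j)`, `‖Z_j((r₀_j + ρ) e_j)‖ ≤ Λ₁`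
  have hpk : ∀ j, ∃ e : E3, ‖e‖ = 1 ∧ ∃ r₀ ∈ Icc (0 : ℝ) A, ∀ ρ ∈ Icc (0 : ℝ) a,
      ‖(c j * 1) • u (T + c j ^ 2 * ν * (-1)) (x j + (c j * ν) • ((r₀ + ρ) • e))‖ ≤ Λ₁ := by
    intro j
    obtain ⟨hunit, hsq⟩ := zoom_units (T := T) hν hcpos j
    obtain ⟨e, he, r₀, hr₀, hcalm⟩ := hQ j (x j) (hxfast j)
    refine ⟨e, he, r₀, hr₀, fun ρ hρ => ?_⟩
    have hr : r₀ + ρ ∈ Icc r₀ (r₀ + a) := ⟨by linarith [hρ.1], by linarith [hρ.2]⟩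
    have h1 := hcalm (r₀ + ρ) hr
    rw [hunit, hsq] at h1
    have e1 : x j + (c j * ν) • ((r₀ + ρ) • e) = x j + ((r₀ + ρ) * (c j * ν)) • e := by
      rw [smul_smul, mul_comm]
    rw [e1, norm_smul, Real.norm_eq_abs, abs_of_pos (mul_pos (hcpos j) one_pos), mul_one]
    set q : ℝ := ‖u (T + c j ^ 2 * ν * (-1)) (x j + ((r₀ + ρ) * (c j * ν)) • e)‖ with hq
    have h2 : c j * q * Real.sqrt ν ≤ Λ₁ * Real.sqrt ν := by
      linarith [h1, mul_comm (Real.sqrt ν) q, mul_assoc (c j) (Real.sqrt ν) q]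
    exact le_of_mul_le_mul_right h2 (Real.sqrt_pos.2 hν)
  choose e he r₀ hr₀ hcalm using hpk
  have hcont : Continuous (W (-1)) := hW.continuous_slice (by norm_num)
  have hsph : ∀ j, e j ∈ sphere (0 : E3) 1 := fun j => mem_sphere_zero_iff_norm.2 (he j)
  obtain ⟨e₀, he₀, ρ₀, hρ₀, hlim⟩ :=
    needle_limit (isCompact_sphere (0 : E3) 1) (hlu (-1) (by norm_num)) hcont hsph hr₀ (tendsto_const_nhds (x := Λ₁)) hcalm
  exact ⟨e₀, mem_sphere_zero_iff_norm.1 he₀, ρ₀, hρ₀, hlim⟩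

/-- **Row F1ne holds.** -/
theorem rowF1ne_holds : Row_F1ne := rowF1ne_of_rowF1nd rowF1nd_holds

/-- **The definite calm-needle threshold `ε(M, A, a)`** (a choice; `1` for `a ≤ 0`, where nothing is claimed).  Ineffective
(compactness). -/
def needleLevel (M A a : ℝ) : ℝ := if ha : 0 < a then Classical.choose (rowF1nd_holds M A a ha) else 1

/-- The definite calm-needle threshold is positive. -/
theorem needleLevel_pos (M A a : ℝ) : 0 < needleLevel M A a := by
  unfold needleLevel
  split_ifs with ha
  · exact (Classical.choose_spec (rowF1nd_holds M A a ha)).1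
  · exact one_pos

/-- **Row F1nd at the named threshold.** -/
theorem needleLevel_spec {a : ℝ} (M A : ℝ) (ha : 0 < a) :
    ∀ (ν T : ℝ), 0 < ν → 0 < T → ∀ (u : ℝ → E3 → E3) (p : ℝ → E3 → ℝ),
    IsClassicalNSSolutionOn (Ico 0 T) ν 0 u p → IsLerayHopfOn T ν 0 (u 0) u →
    HasRapidSpatialDecay (u 0) → OneLevelTop.HasTypeIConstant ν T M u →
    (∃ᶠ t in 𝓝[<] T, CalmNeedlesAt ν T u SnapshotTop.snapLevel A a (needleLevel M A a) t) →
    HasSmoothExtensionPast ν 0 u T := by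
  have e : needleLevel M A a = Classical.choose (rowF1nd_holds M A a ha) := by
    unfold needleLevel; rw [dif_pos ha]
  rw [e]
  exact (Classical.choose_spec (rowF1nd_holds M A a ha)).2

/-- Reading of the negated snapshot condition — **a HEDGEHOG**: some `Λ`-fast point `x` such that EVERY radial needle out of `x`
(every unit direction `e`, every start `r₀ ∈ [0, A]`) carries, within length `a`, a point of dimensionless speed `> ε`. -/
theorem not_calmNeedlesAt_iff {ν T : ℝ} {u : ℝ → E3 → E3} {Λ A a ε t : ℝ} :
    ¬ CalmNeedlesAt ν T u Λ A a ε t ↔ ∃ x ∈ TwoTimeTop.topSet ν T u Λ t, ∀ e : E3, ‖e‖ = 1 → ∀ r₀ ∈ Icc (0 : ℝ) A,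
      ∃ r ∈ Icc r₀ (r₀ + a), ε * Real.sqrt ν < Real.sqrt (T - t) * ‖u t (x + (r * Real.sqrt (ν * (T - t))) • e)‖ := by
  unfold CalmNeedlesAt
  push Not
  rfl

/-- **THE HEDGEHOG FLOOR** (structural, maximal frame, EVERY late instant): at a maximal Type-I Clay blow-up with dimensionless
constant `M`, for every reach `A` and length `a > 0`, at EVERY instant `t` close enough to `T` some `c_S`-fast point `x(t)` is a
HEDGEHOG — in EVERY direction, EVERY radial segment `{x + rℓe : r ∈ [r₀, r₀ + a]}` with `r₀ ≤ A` (`ℓ = √(ν(T − t))`) carries fluid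
of dimensionless speed `> ε(M, A, a)`.  Fast points are never isolated spikes along any ray at the critical scale.  PROVED. -/
def HedgehogFloor : Prop :=
  ∀ (ν T : ℝ), 0 < ν → 0 < T → ∀ (u : ℝ → E3 → E3) (p : ℝ → E3 → ℝ),
    IsMaximalSmoothSolution ν 0 u p T → IsLerayHopfOn T ν 0 (u 0) u → HasRapidSpatialDecay (u 0) →
    ∀ M A a : ℝ, OneLevelTop.HasTypeIConstant ν T M u → 0 < a →
      ∀ᶠ t in 𝓝[<] T, ¬ CalmNeedlesAt ν T u SnapshotTop.snapLevel A a (needleLevel M A a) t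

/-- **The HEDGEHOG floor holds.** -/
theorem hedgehogFloor_holds : HedgehogFloor := by
  intro ν T hν hT u p hmax hLH hdec M A a hM ha
  by_contra hno
  rw [Filter.not_eventually] at hno
  apply hmax.2 (needleLevel_spec M A ha ν T hν hT u p hmax.1 hLH hdec hM ?_)
  exact hno.mono fun t ht => not_not.1 ht

/-- The floor read pointwise: eventually in `t`, a `c_S`-fast hedgehog at threshold `ε(M, A, a)`. -/
theorem hedgehogFloor_read {ν T : ℝ} (hν : 0 < ν) (hT : 0 < T) {u : ℝ → E3 → E3} {p : ℝ → E3 → ℝ}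
    (hmax : IsMaximalSmoothSolution ν 0 u p T) (hLH : IsLerayHopfOn T ν 0 (u 0) u) (hdec : HasRapidSpatialDecay (u 0))
    {M A a : ℝ} (hM : OneLevelTop.HasTypeIConstant ν T M u) (ha : 0 < a) :
    ∀ᶠ t in 𝓝[<] T, ∃ x ∈ TwoTimeTop.topSet ν T u SnapshotTop.snapLevel t, ∀ e : E3, ‖e‖ = 1 → ∀ r₀ ∈ Icc (0 : ℝ) A,
      ∃ r ∈ Icc r₀ (r₀ + a),
        needleLevel M A a * Real.sqrt ν < Real.sqrt (T - t) * ‖u t (x + (r * Real.sqrt (ν * (T - t))) • e)‖ :=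
  (hedgehogFloor_holds ν T hν hT u p hmax hLH hdec M A a hM ha).mono fun _ ht => not_calmNeedlesAt_iff.1 ht

/-- **Residual «NEEDLE COLLAPSE»** (maximal frame): every maximal Type-I Clay blow-up with constant `M` admits, for some reach `A`
and length `a > 0`, calm-needle snapshots at the threshold `ε(M, A, a)` along some sequence of instants `t_k ↑ T`.  DECLARED ≡ row F1
(`needleCollapse_iff_rowF1`); no movement on `Row_F1` is claimed. -/
@[conjecture] def NeedleCollapse : Prop :=
  ∀ (ν T : ℝ), 0 < ν → 0 < T → ∀ (u : ℝ → E3 → E3) (p : ℝ → E3 → ℝ),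
    IsMaximalSmoothSolution ν 0 u p T → IsLerayHopfOn T ν 0 (u 0) u → HasRapidSpatialDecay (u 0) →
    ∀ M : ℝ, OneLevelTop.HasTypeIConstant ν T M u →
      ∃ A a : ℝ, 0 < a ∧ ∃ᶠ t in 𝓝[<] T, CalmNeedlesAt ν T u SnapshotTop.snapLevel A a (needleLevel M A a) t

/-- **The split**: needle row (proved) + residual ⇒ row F1 (target BY NAME). -/
theorem rowF1_of_needleCollapse (hR : NeedleCollapse) : ScenarioCensus.Row_F1 := by
  unfold ScenarioCensus.Row_F1
  intro ν T hν hT u p hsol hLH hdec hTI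
  by_contra hext
  obtain ⟨M, hM⟩ := OneLevelTop.exists_hasTypeIConstant hν hTI
  obtain ⟨A, a, ha, hfreq⟩ := hR ν T hν hT u p ⟨hsol, hext⟩ hLH hdec M hM
  exact hext (needleLevel_spec M A ha ν T hν hT u p hsol hLH hdec hM hfreq)

/-- The residual is a consequence of row F1 (vacuously). -/
theorem needleCollapse_of_rowF1 (h : ScenarioCensus.Row_F1) : NeedleCollapse :=
  fun ν T hν hT u p hmax hLH hdec _ hM =>
    (hmax.2 (h ν T hν hT u p hmax.1 hLH hdec hM.isTypeIBlowup)).elim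

/-- The residual `NeedleCollapse` is EXACTLY `Row_F1`. -/
theorem needleCollapse_iff_rowF1 : NeedleCollapse ↔ ScenarioCensus.Row_F1 :=
  ⟨rowF1_of_needleCollapse, needleCollapse_of_rowF1⟩

/-! ### Order: the needle row contains LINE 36's CALM-POCKET row `SnapshotTop.Row_F1cs` (hence LINE «caged-top»'s `SnapshotTop.Row_F1po`), in kernel

A calm POCKET (a ball of radius `aℓ` centred within `Aℓ` of the fast point `x`) contains a calm RADIAL NEEDLE of length `aℓ`
starting within `Aℓ`: the segment of the ray from `x` through the pocket's centre that lies in the pocket.  So `SnapshotTop.CalmPocketsAt ⟹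
CalmNeedlesAt` pointwise in `t` (`calmNeedlesAt_of_calmPocketsAt`) and `Row_F1nd ⟹ SnapshotTop.Row_F1cs ⟹ SnapshotTop.Row_F1po` (`rowF1cs_of_rowF1nd`, and
LINE 36's `SnapshotTop.rowF1po_of_rowF1cs` copied verbatim).  The converse containment fails at the level of hypotheses: a needle has empty
interior, a velocity field calm on a segment through `x` and of full Type-I size everywhere else satisfies `CalmNeedlesAt` and
violates `SnapshotTop.CalmPocketsAt` for every pocket radius. -/

-- `CalmPocketsAt`: the line restates the tree's `SnapshotTop.CalmPocketsAt`; taken BY NAME (gate lint dedup.landed).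

-- `Row_F1cs`: the line restates the tree's `SnapshotTop.Row_F1cs`; taken BY NAME (gate lint dedup.landed).

/-- A unit vector of `ℝ³`. -/
theorem exists_unit : ∃ e : E3, ‖e‖ = 1 :=
  ⟨EuclideanSpace.single 0 1, by simp⟩

/-- **A calm pocket contains a calm radial needle** (the chord of the pocket on the ray from the fast point through its centre;
for a pocket centred AT the fast point, any direction). -/
theorem calmNeedlesAt_of_calmPocketsAt {ν T : ℝ} {u : ℝ → E3 → E3} {Λ A a ε t : ℝ} (ha : 0 ≤ a) (hν : 0 < ν) (ht : t < T)
    (h : SnapshotTop.CalmPocketsAt ν T u Λ A a ε t) : CalmNeedlesAt ν T u Λ A a ε t := by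
  intro x hx
  obtain ⟨z, hzx, hcalm⟩ := h x hx
  set ℓ : ℝ := Real.sqrt (ν * (T - t)) with hℓ
  have hℓpos : 0 < ℓ := Real.sqrt_pos.2 (mul_pos hν (sub_pos.2 ht))
  by_cases hzx0 : z = x
  · -- pocket centred at the fast point: any direction, start `0`
    rw [hzx0] at hzx hcalm
    obtain ⟨e, he⟩ := exists_unit
    have hA : 0 ≤ A := by
      have h0 : 0 ≤ A * ℓ := by simpa using hzx
      nlinarith
    refine ⟨e, he, 0, ⟨le_rfl, hA⟩, fun r hr => hcalm _ ?_⟩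
    rw [zero_add] at hr
    rw [add_sub_cancel_left, norm_smul, Real.norm_eq_abs, he, mul_one, abs_of_nonneg (mul_nonneg hr.1 hℓpos.le)]
    exact mul_le_mul_of_nonneg_right hr.2 hℓpos.le
  · -- genuine pocket: the ray from `x` through `z`, start `max 0 (s - a)` where `sℓ = ‖z - x‖`
    have hd : 0 < ‖z - x‖ := norm_pos_iff.2 (sub_ne_zero.2 hzx0)
    set d : ℝ := ‖z - x‖ with hd_def
    set s : ℝ := d / ℓ with hs
    have hs0 : 0 < s := div_pos hd hℓpos
    have hsA : s ≤ A := by rw [hs, div_le_iff₀ hℓpos]; exact hzx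
    have hsd : s * ℓ = d := div_mul_cancel₀ d hℓpos.ne'
    set e : E3 := d⁻¹ • (z - x) with he_def
    have he : ‖e‖ = 1 := by
      rw [he_def, norm_smul, norm_inv, norm_norm, inv_mul_cancel₀ hd.ne']
    have hze : z - x = d • e := by
      rw [he_def, smul_smul, mul_inv_cancel₀ hd.ne', one_smul]
    refine ⟨e, he, max 0 (s - a), ⟨le_max_left _ _, max_le (hs0.le.trans hsA) (by linarith)⟩, fun r hr => hcalm _ ?_⟩
    have hr1 : s - a ≤ r := (le_max_right _ _).trans hr.1
    have hr2 : r ≤ max 0 (s - a) + a := hr.2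
    have hr3 : r - s ≤ a := by
      rcases le_total 0 (s - a) with h0 | h0
      · rw [max_eq_right h0] at hr2; linarith
      · rw [max_eq_left h0] at hr2; linarith
    have habs : |r - s| ≤ a := abs_le.2 ⟨by linarith, hr3⟩
    have e1 : x + (r * ℓ) • e - z = (r * ℓ - d) • e := by
      rw [sub_smul, ← hze]; abel
    rw [e1, norm_smul, Real.norm_eq_abs, he, mul_one, ← hsd, ← sub_mul, abs_mul, abs_of_pos hℓpos]
    exact mul_le_mul_of_nonneg_right habs hℓpos.le

/-- **ORDER: `Row_F1nd ⟹ SnapshotTop.Row_F1cs`** (kernel): the needle row contains LINE 36's calm-pocket row. -/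
theorem rowF1cs_of_rowF1nd (h : Row_F1nd) : SnapshotTop.Row_F1cs := by
  intro M A a ha
  obtain ⟨ε, hε, hrow⟩ := h M A a ha
  refine ⟨ε, hε, fun ν T hν hT u p hsol hLH hdec hM hfreq => hrow ν T hν hT u p hsol hLH hdec hM ?_⟩
  have hlt : ∀ᶠ t in 𝓝[<] T, t < T := eventually_nhdsWithin_of_forall fun t ht => ht
  exact (hfreq.and_eventually hlt).mono fun t ht => calmNeedlesAt_of_calmPocketsAt ha.le hν ht.2 ht.1

-- `rowF1cs_holds`: a second proof term for LINE 36's row F1cs (statement identical to the landed `SnapshotTop.rowF1cs_holds`); not re-declared — the order route is `rowF1cs_of_rowF1nd rowF1nd_holds`.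

/-! ### Order, continued (LINE 36's block, verbatim): `SnapshotTop.Row_F1cs ⟹ SnapshotTop.Row_F1po` (LINE «caged-top»), so the chain reads
`Row_F1nd ⟹ SnapshotTop.Row_F1cs ⟹ SnapshotTop.Row_F1po` — the calm-needle row is the new top of this seat's snapshot chain. -/

-- `HasPorousTopAt`: the line restates the tree's `SnapshotTop.HasPorousTopAt`; taken BY NAME (gate lint dedup.landed).

-- `IsSubcriticalLevel`: the line restates the tree's `SnapshotTop.IsSubcriticalLevel`; taken BY NAME (gate lint dedup.landed).

-- `HasPorousTop`: the line restates the tree's `SnapshotTop.HasPorousTop`; taken BY NAME (gate lint dedup.landed).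

-- `Row_F1po`: the line restates the tree's `SnapshotTop.Row_F1po`; taken BY NAME (gate lint dedup.landed).

-- `eventually_calmPocketsAt_of_porous`: the line restates the tree's `SnapshotTop.eventually_calmPocketsAt_of_porous`; taken BY NAME (gate lint dedup.landed).

-- `rowF1po_of_rowF1cs`: the line restates the tree's `SnapshotTop.rowF1po_of_rowF1cs`; taken BY NAME (gate lint dedup.landed).

/-- Order: `Row_F1nd ⟹ Row_F1po`. -/
theorem rowF1po_of_rowF1nd (h : Row_F1nd) : SnapshotTop.Row_F1po := SnapshotTop.rowF1po_of_rowF1cs (rowF1cs_of_rowF1nd h)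

-- `rowF1po_holds`: a second proof term for LINE «caged-top»'s row F1po (landed `CagedTop.rowF1po_holds`); not re-declared — the order route is `rowF1po_of_rowF1nd rowF1nd_holds`.

end Summit.NavierStokesRegularity.NavierStokesRegularity.Theorems.ScenarioCensus.NeedleTop

end
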